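import Literature.NumberTheory.PAdicHodge.TateAlmostEtaleCyclotomicSums
import Literature.NumberTheory.LocalFields.PadicRootsOfUnity
import HarnessLib

/-!
# Tate's almost étale lemma — torsion of `ℤ_p^×` and the action of `Gal(F̄/F_∞)` on `ζ_{p^n}`

The local group `Γ_{F_∞} = χ⁻¹(μ(ℤ_p)) ≤ Γ_F` (`F_∞/F` the cyclotomic `ℤ_p`-extension) acts on the
`p`-power roots of unity through TORSION elements of `ℤ_p^×`.  We record the structure of that torsion
in the form the layer argument (`TateAlmostEtaleCyclotomicSums`) consumes:

* `sq_eq_one_of_pow_prime_pow_eq_one` : in `K₀ = ℚ_p`, `u^{p^k} = 1 ⇒ u² = 1`, and `u = 1` for `p` odd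
  (`Φ_{p^m}` is irreducible over `ℚ_p`, `CyclotomicTower.irreducible_cyclotomic`);
* `torsion_padicBase` : a root of unity `u ∈ ℚ_p` satisfies `u^{p−1} = 1` (`p` odd), `u = ±1` (`p = 2`)
  (with the tree's `dvd_sub_one_of_isPrimitiveRoot_padic`);
* `smul_zeta_of_isOfFinOrder_two`, `smul_zeta_mem_image_of_isOfFinOrder` : consequences for
  `g ∈ G₀ = Gal(F̄/K₀)` with `χ(g)` torsion acting on `ζ_{p^n}`;
* in a finite layer `Ω ∋ ζ = ζ_{p^n}` with a subgroup `A ≤ Gal(Ω/K₀)` all of whose elements are induced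
  by such `g`: `zeta_dichotomy_of_torsion` (`p = 2`: `a ζ = ζ^{±1}`), `card_quotient_inf_le_of_torsion`
  (`[A : A ∩ Stab ζ] ≤ p`), `not_dvd_card_quotient_inf_of_torsion` (`p ∤ [A : A ∩ Stab ζ]`, `p` odd), and
  `exists_fixed_norm_between` : `A`-fixed integral `λ = (∏_{s ∈ A/(A ∩ Stab ζ)} (sζ − 1))^j` with
  `β‖ζ − 1‖^p < ‖λ‖ ≤ β` for any prescribed `0 < β < 1`.

No `sorry`, no definitions.

References: J.-P. Serre, *Local Fields*, Ch. IV §4 (structure of `ℤ_p^×`, `Gal(ℚ_p(ζ_{p^n})/ℚ_p)`)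
[SerreLocalFields1979]; J. Tate, *p-divisible groups* (1967) §3.2 [Tate1967].
-/

noncomputable section

open scoped Classical
open Polynomial Finset IntermediateField

namespace Literature.NumberTheory.PAdicHodge.TateAlmostEtale

open ValuativeRel CyclotomicTower BaseGaloisGroup
open Literature.NumberTheory.GaloisRepresentations
open Literature.NumberTheory.GaloisRepresentations.IsNonarchimedeanLocalField

variable {F : Type} [Field F] [ValuativeRel F] [TopologicalSpace F] [IsNonarchimedeanLocalField F]
  [CharZero F] {p : ℕ} [Fact p.Prime] (hp : valuation F p < 1)

/-! ## Torsion in `ℚ_p^×` -/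

/-- A primitive `p^i`-th root of unity in `ℚ_p` with `i ≥ 1` forces `p = 2` and `i = 1`
(`Φ_{p^i}` is irreducible of degree `φ(p^i)` over `ℚ_p` and has the root, so `φ(p^i) = 1`).
[cite: SerreLocalFields1979, Ch. IV §4] -/
theorem eq_two_of_isPrimitiveRoot_prime_pow {u : PadicBase F p hp} {i : ℕ} (hi : 1 ≤ i)
    (hu : IsPrimitiveRoot u (p ^ i)) : p = 2 ∧ i = 1 := by
  have hp' : p.Prime := Fact.out
  haveI : NeZero ((p ^ i : ℕ) : PadicBase F p hp) := ⟨by exact_mod_cast pow_ne_zero i hp'.ne_zero⟩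
  have hroot : (cyclotomic (p ^ i) (PadicBase F p hp)).IsRoot u := isRoot_cyclotomic_iff.mpr hu
  have hdeg := degree_eq_one_of_irreducible_of_root (irreducible_cyclotomic hp hi) hroot
  rw [degree_cyclotomic, Nat.totient_prime_pow hp' (by omega)] at hdeg
  have h1 : p ^ (i - 1) * (p - 1) = 1 := by exact_mod_cast hdeg
  rw [mul_eq_one] at h1
  obtain ⟨hpi, hp1⟩ := h1
  have hp2 : p = 2 := by have := hp'.two_le; omega
  subst hp2
  refine ⟨rfl, ?_⟩
  by_contra hne
  have : 2 ≤ 2 ^ (i - 1) := Nat.le_self_pow (by omega) 2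
  omega

/-- In `K₀ = ℚ_p`: `u^{p^k} = 1` implies `u² = 1`, and `u = 1` when `p` is odd (no `p`-power roots of
unity in `ℚ_p` beyond `±1`). [cite: SerreLocalFields1979, Ch. IV §4] -/
theorem sq_eq_one_of_pow_prime_pow_eq_one {u : PadicBase F p hp} {k : ℕ} (hu : u ^ p ^ k = 1) :
    u ^ 2 = 1 ∧ (p ≠ 2 → u = 1) := by
  have hp' : p.Prime := Fact.out
  obtain ⟨j, -, hj⟩ := (Nat.dvd_prime_pow hp').1 (orderOf_dvd_of_pow_eq_one hu)
  have hprim : IsPrimitiveRoot u (p ^ j) := hj ▸ IsPrimitiveRoot.orderOf u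
  rcases Nat.eq_zero_or_pos j with hj0 | hjpos
  · rw [hj0, pow_zero] at hj
    have hu1 : u = 1 := orderOf_eq_one_iff.mp hj
    exact ⟨by rw [hu1, one_pow], fun _ => hu1⟩
  · obtain ⟨hp2, hj1⟩ := eq_two_of_isPrimitiveRoot_prime_pow hp hjpos hprim
    subst hp2; subst hj1
    refine ⟨?_, fun h => absurd rfl h⟩
    have := pow_orderOf_eq_one u
    rwa [hj] at this

/-- **Torsion of `ℚ_p^×`**: a root of unity `u ∈ ℚ_p` satisfies `u^{p−1} = 1` if `p` is odd and
`u = ±1` if `p = 2` (order `= p^e·d'` with `p ∤ d'`; the `p`-part is killed by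
`sq_eq_one_of_pow_prime_pow_eq_one`, and `d' ∣ p − 1` by the tree's
`dvd_sub_one_of_isPrimitiveRoot_padic`). [cite: SerreLocalFields1979, Ch. IV §4 (and Ch. II §4 Prop. 8)] -/
theorem torsion_padicBase {u : PadicBase F p hp} (hu : IsOfFinOrder u) :
    (p ≠ 2 → u ^ (p - 1) = 1) ∧ (p = 2 → u = 1 ∨ u = -1) := by
  have hp' : p.Prime := Fact.out
  set d := orderOf u with hd
  have hdpos : 0 < d := hu.orderOf_pos
  obtain ⟨e, d', hd', hdeq⟩ := Nat.exists_eq_pow_mul_and_not_dvd hdpos.ne' p hp'.one_lt.ne'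
  have hprim : IsPrimitiveRoot u d := IsPrimitiveRoot.orderOf u
  -- the prime-to-`p` part divides `p - 1`
  have hv : IsPrimitiveRoot (u ^ p ^ e) d' := hprim.pow hdpos hdeq
  have hv' : IsPrimitiveRoot (PadicBase.toPadic hp (u ^ p ^ e)) d' :=
    hv.map_of_injective (PadicBase.toPadic hp).injective
  have hdvd : d' ∣ p - 1 := Literature.NumberTheory.LocalFields.dvd_sub_one_of_isPrimitiveRoot_padic hd' hv'
  -- the `p`-part is killed
  have hw : IsPrimitiveRoot (u ^ d') (p ^ e) := hprim.pow hdpos (hdeq.trans (mul_comm _ _))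
  have hw1 : (u ^ d') ^ p ^ e = 1 := hw.pow_eq_one
  obtain ⟨hsq, hodd⟩ := sq_eq_one_of_pow_prime_pow_eq_one hp hw1
  refine ⟨fun hp2 => ?_, fun hp2 => ?_⟩
  · obtain ⟨c, hc⟩ := hdvd
    rw [hc, pow_mul, hodd hp2, one_pow]
  · subst hp2
    have hd1 : d' = 1 := Nat.dvd_one.mp (by simpa using hdvd)
    rw [hd1, pow_one] at hsq
    rwa [pow_two, mul_self_eq_one_iff] at hsq

/-! ## The cyclotomic character of `G₀` on torsion elements -/

/-- For `g ∈ G₀` with `χ(g)` of finite order: `χ(g)`, read in `K₀`, is a root of unity. Auxiliary.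
[folklore] -/
private theorem isOfFinOrder_ofPadicInt_baseChar {g : BaseGaloisGroup hp}
    (hg : IsOfFinOrder (baseCyclotomicCharacter hp g)) :
    IsOfFinOrder (PadicBase.ofPadicInt hp (baseCyclotomicCharacter hp g : ℤ_[p])) := by
  obtain ⟨d, hd, hd1⟩ := hg.exists_pow_eq_one
  refine isOfFinOrder_iff_pow_eq_one.mpr ⟨d, hd, ?_⟩
  rw [← map_pow, ← Units.val_pow_eq_pow_val, hd1, Units.val_one, map_one]

/-- `p = 2`: a torsion value of the cyclotomic character is `±1`. [cite: SerreLocalFields1979, Ch. II §4 Prop. 8] -/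
theorem baseChar_eq_one_or_eq_neg_one (hp2 : p = 2) {g : BaseGaloisGroup hp}
    (hg : IsOfFinOrder (baseCyclotomicCharacter hp g)) :
    (baseCyclotomicCharacter hp g : ℤ_[p]) = 1 ∨ (baseCyclotomicCharacter hp g : ℤ_[p]) = -1 := by
  rcases (torsion_padicBase hp (isOfFinOrder_ofPadicInt_baseChar hp hg)).2 hp2 with h | h
  · left
    apply PadicBase.ofPadicInt_injective hp
    rw [h, map_one]
  · right
    apply PadicBase.ofPadicInt_injective hp
    rw [h, map_neg, map_one]

/-- `p` odd: a torsion value `u` of the cyclotomic character satisfies `u^{p−1} = 1`.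
[cite: SerreLocalFields1979, Ch. II §4 Prop. 8] -/
theorem baseChar_pow_sub_one_eq_one (hp2 : p ≠ 2) {g : BaseGaloisGroup hp}
    (hg : IsOfFinOrder (baseCyclotomicCharacter hp g)) :
    (baseCyclotomicCharacter hp g : ℤ_[p]) ^ (p - 1) = 1 := by
  have h := (torsion_padicBase hp (isOfFinOrder_ofPadicInt_baseChar hp hg)).1 hp2
  apply PadicBase.ofPadicInt_injective hp
  rw [map_pow, h, map_one]

/-- **`p = 2`: an element of `G₀` with torsion cyclotomic character acts on `ζ_{2^n}` (`n ≥ 1`) by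
`ζ ↦ ζ^{±1}`.** [cite: SerreLocalFields1979, Ch. IV §4] -/
theorem smul_zeta_of_isOfFinOrder_two (hp2 : p = 2) {n : ℕ} (hn : 1 ≤ n) {g : BaseGaloisGroup hp}
    (hg : IsOfFinOrder (baseCyclotomicCharacter hp g)) :
    g • zeta F p n = zeta F p n ∨ g • zeta F p n = (zeta F p n)⁻¹ := by
  have hp' : p.Prime := Fact.out
  have hζ := zeta_spec F p n
  have hspec := baseCyclotomicCharacter_spec hp g (k := n) (zeta F p n) hζ.pow_eq_one
  have hlt : 1 < p ^ n := Nat.one_lt_pow (by omega) hp'.one_lt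
  haveI : Fact (1 < p ^ n) := ⟨hlt⟩
  rcases baseChar_eq_one_or_eq_neg_one hp hp2 hg with h | h
  · left
    rw [hspec, h, map_one, ZMod.val_one, pow_one]
  · right
    rw [hspec, h, map_neg, map_one]
    obtain ⟨k, hk⟩ : ∃ k, p ^ n = k + 1 := ⟨p ^ n - 1, by omega⟩
    have hval : ((-1 : ZMod (p ^ n))).val = k := by
      rw [hk]; exact ZMod.val_neg_one k
    rw [hval, show k = p ^ n - 1 by omega, pow_sub₀ _ (hζ.ne_zero (by positivity)) (by omega : 1 ≤ p ^ n),
      hζ.pow_eq_one, pow_one, one_mul]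

/-- **`p` odd: an element of `G₀` with torsion cyclotomic character moves `ζ_{p^n}` inside the set
`{ζ^u : u^{p−1} = 1 in ℤ_p}`, which has at most `p − 1` elements.** [cite: SerreLocalFields1979, Ch. IV §4] -/
theorem smul_zeta_mem_image_of_isOfFinOrder (hp2 : p ≠ 2) (n : ℕ) {g : BaseGaloisGroup hp}
    (hg : IsOfFinOrder (baseCyclotomicCharacter hp g)) :
    g • zeta F p n ∈ ((nthRoots (p - 1) (1 : ℤ_[p])).toFinset).image
      (fun u : ℤ_[p] => zeta F p n ^ (PadicInt.toZModPow n u).val) := by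
  have hp' : p.Prime := Fact.out
  rw [Finset.mem_image]
  refine ⟨(baseCyclotomicCharacter hp g : ℤ_[p]), ?_,
    (baseCyclotomicCharacter_spec hp g (k := n) (zeta F p n) (zeta_spec F p n).pow_eq_one).symm⟩
  rw [Multiset.mem_toFinset, mem_nthRoots (by have := hp'.two_le; omega)]
  exact baseChar_pow_sub_one_eq_one hp hp2 hg

/-- The set `{ζ^u : u^{p−1} = 1 in ℤ_p}` has at most `p − 1` elements. [folklore] -/
private theorem card_image_nthRoots_le (n : ℕ) :
    (((nthRoots (p - 1) (1 : ℤ_[p])).toFinset).image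
      (fun u : ℤ_[p] => zeta F p n ^ (PadicInt.toZModPow n u).val)).card ≤ p - 1 :=
  Finset.card_image_le.trans ((Multiset.toFinset_card_le _).trans (card_nthRoots _ _))

include hp in
/-- `‖ζ_{p^n} − 1‖ < 1` for `n ≥ 1` (`ζ_{p^n} − 1` is a uniformizer of `ℚ_p(ζ_{p^n})`).
[cite: SerreLocalFields1979, Ch. IV §4 Prop. 17] -/
theorem norm_zeta_sub_one_lt_one {n : ℕ} (hn : 1 ≤ n) : ‖zeta F p n - 1‖ < 1 := by
  by_contra h
  push Not at h
  have h1 : (1 : ℝ) ≤ ‖zeta F p n - 1‖ ^ (p ^ n).totient := one_le_pow₀ h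
  rw [norm_zeta_sub_one_pow hn, PadicBase.norm_natCast_closure hp] at h1
  exact absurd h1 (not_le.mpr (PadicBase.norm_p_lt_one hp))

/-! ## In a layer: a subgroup acting through torsion characters -/

variable (Ω : IntermediateField (PadicBase F p hp) (NormedAlgClosure F))
  [FiniteDimensional (PadicBase F p hp) Ω]

omit [FiniteDimensional (PadicBase F p hp) Ω] in
/-- **`p = 2`, layer form**: if every `a ∈ A ≤ Gal(Ω/K₀)` is induced by some `g ∈ G₀` with `χ(g)`
torsion, then `a ζ = ζ^{±1}` for `ζ = ζ_{2^n} ∈ Ω`, `n ≥ 1`. [cite: SerreLocalFields1979, Ch. IV §4] -/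
theorem zeta_dichotomy_of_torsion (hp2 : p = 2) {n : ℕ} (hn : 1 ≤ n) {ζΩ : Ω}
    (hζ : (ζΩ : NormedAlgClosure F) = zeta F p n) (A : Subgroup (Ω ≃ₐ[PadicBase F p hp] Ω))
    (hA : ∀ a ∈ A, ∃ g : BaseGaloisGroup hp, IsOfFinOrder (baseCyclotomicCharacter hp g) ∧
      ∀ z : Ω, ((a z : Ω) : NormedAlgClosure F) = g • (z : NormedAlgClosure F)) :
    ∀ a ∈ A, a ζΩ = ζΩ ∨ a ζΩ = ζΩ⁻¹ := by
  intro a ha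
  obtain ⟨g, hg, hga⟩ := hA a ha
  rcases smul_zeta_of_isOfFinOrder_two hp hp2 hn hg with h | h
  · left
    apply Subtype.ext
    rw [hga, hζ, h]
  · right
    apply Subtype.ext
    rw [hga, IntermediateField.coe_inv, hζ, h]

/-- The coset map `A/(A ∩ Stab ζ) → F̄`, `s ↦ s ζ`, is injective. Auxiliary. [folklore] -/
private theorem injOn_quotient_apply_zeta {ζΩ : Ω} (A H : Subgroup (Ω ≃ₐ[PadicBase F p hp] Ω))
    (hH : ∀ g, g ∈ H ↔ g ζΩ = ζΩ) :
    Set.InjOn (fun s : A ⧸ (A ⊓ H).subgroupOf A =>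
      ((((s.out : A) : Ω ≃ₐ[PadicBase F p hp] Ω) ζΩ : Ω) : NormedAlgClosure F))
      (Finset.univ : Finset (A ⧸ (A ⊓ H).subgroupOf A)) := by
  intro s _ s' _ hss'
  have h1 : ((s.out : A) : Ω ≃ₐ[PadicBase F p hp] Ω) ζΩ = ((s'.out : A) : Ω ≃ₐ[PadicBase F p hp] Ω) ζΩ :=
    Subtype.ext hss'
  have hmem : (s.out)⁻¹ * s'.out ∈ (A ⊓ H).subgroupOf A := by
    rw [Subgroup.mem_subgroupOf, Subgroup.mem_inf]
    refine ⟨((s.out)⁻¹ * s'.out).2, ?_⟩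
    rw [hH, Subgroup.coe_mul, Subgroup.coe_inv, AlgEquiv.mul_apply, ← h1, ← AlgEquiv.mul_apply,
      inv_mul_cancel, AlgEquiv.one_apply]
  have := QuotientGroup.eq.mpr hmem
  rwa [QuotientGroup.out_eq', QuotientGroup.out_eq'] at this

/-- **`[A : A ∩ Stab ζ] ≤ p − 1` for `p` odd** when `A` acts through torsion characters: the orbit
`A ζ` lies in `{ζ^u : u^{p−1} = 1}`. [cite: SerreLocalFields1979, Ch. IV §4] -/
theorem card_quotient_inf_le_sub_one_of_torsion (hp2 : p ≠ 2) {n : ℕ} {ζΩ : Ω}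
    (hζ : (ζΩ : NormedAlgClosure F) = zeta F p n) (A H : Subgroup (Ω ≃ₐ[PadicBase F p hp] Ω))
    (hH : ∀ g, g ∈ H ↔ g ζΩ = ζΩ)
    (hA : ∀ a ∈ A, ∃ g : BaseGaloisGroup hp, IsOfFinOrder (baseCyclotomicCharacter hp g) ∧
      ∀ z : Ω, ((a z : Ω) : NormedAlgClosure F) = g • (z : NormedAlgClosure F)) :
    Fintype.card (A ⧸ (A ⊓ H).subgroupOf A) ≤ p - 1 := by
  rw [← Finset.card_univ]
  refine (Finset.card_le_card_of_injOn _ (fun s _ => ?_)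
    (injOn_quotient_apply_zeta hp Ω A H hH)).trans (card_image_nthRoots_le n)
  obtain ⟨g, hg, hga⟩ := hA _ (s.out : A).2
  rw [Finset.mem_coe, hga, hζ]
  exact smul_zeta_mem_image_of_isOfFinOrder hp hp2 n hg

/-- **`[A : A ∩ Stab ζ] ≤ 2` for `p = 2`** (`n ≥ 1`) when `A` acts through torsion characters.
[cite: SerreLocalFields1979, Ch. IV §4] -/
theorem card_quotient_inf_le_two_of_torsion (hp2 : p = 2) {n : ℕ} (hn : 1 ≤ n) {ζΩ : Ω}
    (hζ : (ζΩ : NormedAlgClosure F) = zeta F p n) (A H : Subgroup (Ω ≃ₐ[PadicBase F p hp] Ω))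
    (hH : ∀ g, g ∈ H ↔ g ζΩ = ζΩ)
    (hA : ∀ a ∈ A, ∃ g : BaseGaloisGroup hp, IsOfFinOrder (baseCyclotomicCharacter hp g) ∧
      ∀ z : Ω, ((a z : Ω) : NormedAlgClosure F) = g • (z : NormedAlgClosure F)) :
    Fintype.card (A ⧸ (A ⊓ H).subgroupOf A) ≤ 2 := by
  rw [← Finset.card_univ]
  refine (Finset.card_le_card_of_injOn _ (fun s _ => ?_)
    (injOn_quotient_apply_zeta hp Ω A H hH)).trans
    (Finset.card_le_two (a := zeta F p n) (b := (zeta F p n)⁻¹))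
  obtain ⟨g, hg, hga⟩ := hA _ (s.out : A).2
  rw [Finset.mem_coe, hga, hζ, Finset.mem_insert, Finset.mem_singleton]
  exact smul_zeta_of_isOfFinOrder_two hp hp2 hn hg

/-- **`[A : A ∩ Stab ζ] ≤ p`** (`n ≥ 1`) when `A` acts through torsion characters.
[cite: SerreLocalFields1979, Ch. IV §4] -/
theorem card_quotient_inf_le_of_torsion {n : ℕ} (hn : 1 ≤ n) {ζΩ : Ω}
    (hζ : (ζΩ : NormedAlgClosure F) = zeta F p n) (A H : Subgroup (Ω ≃ₐ[PadicBase F p hp] Ω))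
    (hH : ∀ g, g ∈ H ↔ g ζΩ = ζΩ)
    (hA : ∀ a ∈ A, ∃ g : BaseGaloisGroup hp, IsOfFinOrder (baseCyclotomicCharacter hp g) ∧
      ∀ z : Ω, ((a z : Ω) : NormedAlgClosure F) = g • (z : NormedAlgClosure F)) :
    Fintype.card (A ⧸ (A ⊓ H).subgroupOf A) ≤ p := by
  by_cases hp2 : p = 2
  · exact (card_quotient_inf_le_two_of_torsion hp Ω hp2 hn hζ A H hH hA).trans hp2.ge
  · exact (card_quotient_inf_le_sub_one_of_torsion hp Ω hp2 hζ A H hH hA).trans (Nat.sub_le _ _)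

/-- **`p ∤ [A : A ∩ Stab ζ]` for `p` odd** when `A` acts through torsion characters (the index is
positive and `≤ p − 1`). [cite: SerreLocalFields1979, Ch. IV §4] -/
theorem not_dvd_card_quotient_inf_of_torsion (hp2 : p ≠ 2) {n : ℕ} {ζΩ : Ω}
    (hζ : (ζΩ : NormedAlgClosure F) = zeta F p n) (A H : Subgroup (Ω ≃ₐ[PadicBase F p hp] Ω))
    (hH : ∀ g, g ∈ H ↔ g ζΩ = ζΩ)
    (hA : ∀ a ∈ A, ∃ g : BaseGaloisGroup hp, IsOfFinOrder (baseCyclotomicCharacter hp g) ∧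
      ∀ z : Ω, ((a z : Ω) : NormedAlgClosure F) = g • (z : NormedAlgClosure F)) :
    ¬ p ∣ Fintype.card (A ⧸ (A ⊓ H).subgroupOf A) := by
  have hle := card_quotient_inf_le_sub_one_of_torsion hp Ω hp2 hζ A H hH hA
  have hpos : 0 < Fintype.card (A ⧸ (A ⊓ H).subgroupOf A) := Fintype.card_pos
  have hp' : p.Prime := Fact.out
  exact Nat.not_dvd_of_pos_of_lt hpos (by have := hp'.two_le; omega)

/-- The `A`-norm `ν = ∏_{s ∈ A/(A ∩ Stab ζ)} (s ζ − 1)` is fixed by `A` (left multiplication permutes the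
cosets, and the coset representative only changes `s ζ` by an element of `Stab ζ`). Auxiliary.
[folklore] -/
private theorem apply_prod_quotient_zeta_sub_one {ζΩ : Ω} (A H : Subgroup (Ω ≃ₐ[PadicBase F p hp] Ω))
    (hH : ∀ g, g ∈ H ↔ g ζΩ = ζΩ) (a : Ω ≃ₐ[PadicBase F p hp] Ω) (ha : a ∈ A) :
    a (∏ s : A ⧸ (A ⊓ H).subgroupOf A, (((s.out : A) : Ω ≃ₐ[PadicBase F p hp] Ω) ζΩ - 1)) =
      ∏ s : A ⧸ (A ⊓ H).subgroupOf A, (((s.out : A) : Ω ≃ₐ[PadicBase F p hp] Ω) ζΩ - 1) := by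
  set a' : A := ⟨a, ha⟩ with ha'
  rw [map_prod]
  -- each factor: `a (s ζ - 1) = (a' • s) ζ - 1`
  have hfac : ∀ s : A ⧸ (A ⊓ H).subgroupOf A,
      a ((((s.out : A) : Ω ≃ₐ[PadicBase F p hp] Ω) ζΩ - 1)) =
        (((a' • s).out : A) : Ω ≃ₐ[PadicBase F p hp] Ω) ζΩ - 1 := by
    intro s
    rw [map_sub, map_one, ← AlgEquiv.mul_apply]
    congr 1
    obtain ⟨d, hd⟩ := QuotientGroup.mk_out_eq_mul ((A ⊓ H).subgroupOf A) (a' * s.out)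
    have hmk : (QuotientGroup.mk (a' * s.out) : A ⧸ (A ⊓ H).subgroupOf A) = a' • s := by
      rw [← smul_eq_mul, MulAction.Quotient.mk_smul_out]
    rw [hmk] at hd
    have hdH : ((d : A) : Ω ≃ₐ[PadicBase F p hp] Ω) ∈ H := by
      have := d.2
      rw [Subgroup.mem_subgroupOf, Subgroup.mem_inf] at this
      exact this.2
    rw [hd, Subgroup.coe_mul, Subgroup.coe_mul]
    simp only [AlgEquiv.mul_apply]
    rw [(hH _).mp hdH]
  simp_rw [hfac]
  exact Fintype.prod_bijective (fun s => a' • s) (MulAction.bijective a') _ _ (fun s => rfl)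

/-- `‖∏_{s ∈ A/(A ∩ Stab ζ)} (s ζ − 1)‖ = ‖ζ − 1‖^{[A : A ∩ Stab ζ]}` when `A` acts through `G₀`
(isometries). Auxiliary. [folklore] -/
private theorem norm_prod_quotient_zeta_sub_one {n : ℕ} {ζΩ : Ω}
    (hζ : (ζΩ : NormedAlgClosure F) = zeta F p n) (A H : Subgroup (Ω ≃ₐ[PadicBase F p hp] Ω))
    (hA : ∀ a ∈ A, ∃ g : BaseGaloisGroup hp, IsOfFinOrder (baseCyclotomicCharacter hp g) ∧
      ∀ z : Ω, ((a z : Ω) : NormedAlgClosure F) = g • (z : NormedAlgClosure F)) :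
    ‖((∏ s : A ⧸ (A ⊓ H).subgroupOf A, (((s.out : A) : Ω ≃ₐ[PadicBase F p hp] Ω) ζΩ - 1) : Ω) :
        NormedAlgClosure F)‖ = ‖zeta F p n - 1‖ ^ Fintype.card (A ⧸ (A ⊓ H).subgroupOf A) := by
  rw [IntermediateField.coe_prod, norm_prod]
  have hfac : ∀ s : A ⧸ (A ⊓ H).subgroupOf A,
      ‖(((((s.out : A) : Ω ≃ₐ[PadicBase F p hp] Ω) ζΩ - 1 : Ω)) : NormedAlgClosure F)‖ =
        ‖zeta F p n - 1‖ := by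
    intro s
    obtain ⟨g, -, hga⟩ := hA _ (s.out : A).2
    rw [AddSubgroupClass.coe_sub, OneMemClass.coe_one, hga, hζ, ← smul_one g, show
      g • (1 : NormedAlgClosure F) = 1 from smul_one g, ← norm_smul hp g (zeta F p n - 1), smul_sub,
      smul_one]
  rw [Finset.prod_congr rfl (fun s _ => hfac s), Finset.prod_const, Finset.card_univ]

/-- **An `A`-fixed integral element of prescribed size**: for `0 < β < 1` and `ζ = ζ_{p^n} ∈ Ω`
(`n ≥ 1`), when `A ≤ Gal(Ω/K₀)` acts through torsion characters there is `λ ∈ Ω` fixed by `A` with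
`β·‖ζ − 1‖^p < ‖λ‖ ≤ β` — a power of the `A`-norm `∏_{s ∈ A/(A ∩ Stab ζ)} (sζ − 1)`, whose absolute
value `‖ζ − 1‖^{[A : A ∩ Stab ζ]} ≥ ‖ζ − 1‖^p` tends to `1` along the tower.
[cite: Tate1967, §3.2 (proof of Prop. 9)] -/
theorem exists_fixed_norm_between {n : ℕ} (hn : 1 ≤ n) {ζΩ : Ω}
    (hζ : (ζΩ : NormedAlgClosure F) = zeta F p n) (A H : Subgroup (Ω ≃ₐ[PadicBase F p hp] Ω))
    (hH : ∀ g, g ∈ H ↔ g ζΩ = ζΩ)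
    (hA : ∀ a ∈ A, ∃ g : BaseGaloisGroup hp, IsOfFinOrder (baseCyclotomicCharacter hp g) ∧
      ∀ z : Ω, ((a z : Ω) : NormedAlgClosure F) = g • (z : NormedAlgClosure F))
    {β : ℝ} (hβ0 : 0 < β) (hβ1 : β < 1) :
    ∃ lam : Ω, (∀ a ∈ A, a lam = lam) ∧ ‖(lam : NormedAlgClosure F)‖ ≤ β ∧
      β * ‖zeta F p n - 1‖ ^ p < ‖(lam : NormedAlgClosure F)‖ := by
  set ν : Ω := ∏ s : A ⧸ (A ⊓ H).subgroupOf A, (((s.out : A) : Ω ≃ₐ[PadicBase F p hp] Ω) ζΩ - 1)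
    with hν
  have hνA : ∀ a ∈ A, a ν = ν := fun a ha => apply_prod_quotient_zeta_sub_one hp Ω A H hH a ha
  have hνnorm : ‖(ν : NormedAlgClosure F)‖ =
      ‖zeta F p n - 1‖ ^ Fintype.card (A ⧸ (A ⊓ H).subgroupOf A) :=
    norm_prod_quotient_zeta_sub_one hp Ω hζ A H hA
  have hz1 : ‖zeta F p n - 1‖ < 1 := norm_zeta_sub_one_lt_one hp hn
  have hz0 : 0 < ‖zeta F p n - 1‖ := norm_zeta_sub_one_pos hn
  have hk : 0 < Fintype.card (A ⧸ (A ⊓ H).subgroupOf A) := Fintype.card_pos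
  have hν1 : ‖(ν : NormedAlgClosure F)‖ < 1 := by rw [hνnorm]; exact pow_lt_one₀ hz0.le hz1 hk.ne'
  have hν0 : 0 < ‖(ν : NormedAlgClosure F)‖ := by rw [hνnorm]; exact pow_pos hz0 _
  have hex : ∃ j : ℕ, ‖(ν : NormedAlgClosure F)‖ ^ j ≤ β := by
    obtain ⟨j, hj⟩ := exists_pow_lt_of_lt_one hβ0 hν1
    exact ⟨j, hj.le⟩
  set j := Nat.find hex with hj
  have hjspec : ‖(ν : NormedAlgClosure F)‖ ^ j ≤ β := Nat.find_spec hex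
  have hjpos : 0 < j := by
    rw [Nat.pos_iff_ne_zero]
    intro h0
    rw [h0, pow_zero] at hjspec
    exact absurd hjspec (not_le.mpr hβ1)
  have hjmin : β < ‖(ν : NormedAlgClosure F)‖ ^ (j - 1) := by
    have := Nat.find_min hex (show j - 1 < j by omega)
    exact not_le.mp this
  refine ⟨ν ^ j, fun a ha => by rw [map_pow, hνA a ha], ?_, ?_⟩
  · rwa [SubmonoidClass.coe_pow, norm_pow]
  · rw [SubmonoidClass.coe_pow, norm_pow]
    have hkp : Fintype.card (A ⧸ (A ⊓ H).subgroupOf A) ≤ p :=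
      card_quotient_inf_le_of_torsion hp Ω hn hζ A H hH hA
    calc β * ‖zeta F p n - 1‖ ^ p
        ≤ β * ‖(ν : NormedAlgClosure F)‖ := by
          rw [hνnorm]
          exact mul_le_mul_of_nonneg_left (pow_le_pow_of_le_one hz0.le hz1.le hkp) hβ0.le
      _ < ‖(ν : NormedAlgClosure F)‖ ^ (j - 1) * ‖(ν : NormedAlgClosure F)‖ :=
          mul_lt_mul_of_pos_right hjmin hν0
      _ = ‖(ν : NormedAlgClosure F)‖ ^ j := by
          rw [← pow_succ, Nat.sub_add_cancel hjpos]

end Literature.NumberTheory.PAdicHodge.TateAlmostEtale
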